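import Summits.Ventures.Crystal3D.Theorems.StickyWulffConstantTextureLiminfZigOrRows
import Summits.Ventures.Crystal3D.Theorems.StickyWulffConstantTextureLiminfTexShadowCoverageBarlowDefs
import HarnessLib

/-!
# EDGE-ON ⇒ STEEP BASAL TILT: a plate that is not flux-feasible at `13/25` has `sin²(tilt) > 3/5` (lane T, crux `TextureLiminfV5`, stmt-Ventures-23912)

HONEST FRAMING. Venture `Summits/Ventures/Crystal3D` (cell `crystal3d-full`), route `route-Ventures-StickyWulffConstant`, helper `--supports` the
law-v5 crux `TextureLiminfV5` (stmt-Ventures-23912), lane T, registered stub `stub_terraceCensus` (its class `EdgeOnAt (13/25)`).  Pure trigonometry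
of the close-packed frame on top of lane T's …ZigOrRows; standard axioms; nothing about any wall law; F-C1 not moved.

THE POINT.  The (β) plates side is evaluated against the area in TILT currency (…LevelReachPlatesFluxAreaCell / …PlatesOnlyCellLaw:
supply `√6·π·(S₁ + S₂)·(ρ−4)²`, `S_i = √(1 − ν_{i,2}²)` the sine of plate `i`'s basal tilt to the wall).  What the registered class gives:
`EdgeOnAt c₀ σ₁ σ₂ L₁ L₂ := ¬FluxFeasible c₀ L₁ σ₁ e₃ ∧ ¬FluxFeasible c₀ L₂ σ₂ (−e₃)`, `FluxFeasible c₀ L σ e := DeltaSteep L e ∧ ∀ i, √2·c₀ ≤ bilayerRise L σ e i`.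
By `deltaSteep_of_lateral` (…ZigOrRows) a plate with `ν₀² + ν₁² ≤ 2/3` is Δ-steep, and by `exists_lateral_decomp` every zigzag rise is
`M + √(2/3)·t` with `t = |ν₂|`, `ν₀² + ν₁² ≤ 12 M²`; so a bilayer with rise `< √2·13/25` forces `ν₀² + ν₁² > 3/5` (from
`1 − t² ≤ 12 M² < 12 (√2·13/25 − √(2/3)·t)²`, a quadratic inequality in `t` with no solution on `t² ≥ 2/5`; `nlinarith` with rational brackets
of `√2`, `√(2/3)`; the exact threshold is `ν₀² + ν₁² > 0.610`, i.e. basal tilt `> 51.4°`, FAULTED-LEDGER-MEMO §2 «both active tilts beyond 51.3°»):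
* **`lateral_sq_gt_of_not_fluxFeasible`** — `¬FluxFeasible (13/25) L σ e → 3/5 < (L⁻¹e)₀² + (L⁻¹e)₁²` (`‖e‖ = 1`);
* **`sinTilt_sq_gt_of_edgeOnAt`** — `EdgeOnAt (13/25) σ₁ σ₂ L₁ L₂ → 3/5 < 1 − (L₁⁻¹e₃)₂² ∧ 3/5 < 1 − (L₂⁻¹e₃)₂²`;
* `sinTilt_ge_of_edgeOnAt` — hence `√(3/5) ≤ S₁`, `√(3/5) ≤ S₂` and `2·√(3/5) ≤ S₁ + S₂` (so the two plates alone supply `√6·(S₁+S₂) ≥ 3.79` of the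
  `2·c₀·sF = 4.68` needed at `c₀ = 13/25`, `sF = 9/2`; the rest is the born lines' — BETA-CUT-g22 §4(c)).
WHAT THIS IS NOT: the converse; any statement at other caps; F-C1 not moved.
-/

noncomputable section

namespace Summit.Ventures.Crystal3D.Theorems

open Summit.Ventures.Crystal3D
open Summit.Ventures.Crystal3D.Cruxes.TextureLiminf.TexShadow (E3 e₃ FluxFeasible DeltaSteep bilayerRise EdgeOnAt)
open scoped InnerProductSpace

/-- **Not flux-feasible at `13/25` ⇒ the lateral part of the pulled-back normal has square `> 3/5`.** -/
theorem lateral_sq_gt_of_not_fluxFeasible (L : E3 ≃ₗᵢ[ℝ] E3) (σ : ℤ → ℤ) {e : E3} (he : ‖e‖ = 1)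
    (h : ¬ FluxFeasible (13 / 25) L σ e) : 3 / 5 < (L.symm e) 0 ^ 2 + (L.symm e) 1 ^ 2 := by
  by_contra hle
  push Not at hle
  -- the plate is Δ-steep, so some bilayer rises by less than `√2 · 13/25`
  have hΔ : DeltaSteep L e := deltaSteep_of_lateral L he (by linarith)
  have h' : ∃ i : ℤ, bilayerRise L σ e i < Real.sqrt 2 * (13 / 25) := by
    by_contra hall
    push Not at hall
    exact h ⟨hΔ, hall⟩
  obtain ⟨i, hi⟩ := h'
  obtain ⟨M, t, hrise, hM0, ht0, hsum, hM⟩ := exists_lateral_decomp L σ he i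
  rw [hrise] at hi
  -- numerics: `√2 ∈ [1.41421, 1.41422]`, `√(2/3) ∈ [0.81649, 0.8165]`
  have hs2u : Real.sqrt 2 ≤ 1.41422 := by
    rw [show (1.41422 : ℝ) = Real.sqrt (1.41422 ^ 2) by rw [Real.sqrt_sq (by norm_num)]]
    exact Real.sqrt_le_sqrt (by norm_num)
  have hs23l : (0.81649 : ℝ) ≤ Real.sqrt (2 / 3) := by
    rw [show (0.81649 : ℝ) = Real.sqrt (0.81649 ^ 2) by rw [Real.sqrt_sq (by norm_num)]]
    exact Real.sqrt_le_sqrt (by norm_num)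
  -- `t² ≥ 2/5`, and `M + √(2/3) t < √2·13/25` with `1 − t² ≤ 12 M²` is impossible there
  have ht2 : 2 / 5 ≤ t ^ 2 := by nlinarith
  have hMb : M < 1.41422 * (13 / 25) - 0.81649 * t := by nlinarith
  have hMpos : 0 ≤ 1.41422 * (13 / 25) - 0.81649 * t := le_trans hM0 hMb.le
  have hM2 : M ^ 2 ≤ (1.41422 * (13 / 25) - 0.81649 * t) ^ 2 := by nlinarith
  have key : 1 - t ^ 2 ≤ 12 * (1.41422 * (13 / 25) - 0.81649 * t) ^ 2 := by nlinarith
  -- the quadratic `12(0.7353944 − 0.81649 t)² + t² − 1 ≥ 0` has no root with `t² ≥ 2/5`, `0.81649 t ≤ 0.7354`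
  nlinarith [ht0, hMpos, ht2, key, sq_nonneg (t - 0.8)]

/-- **Edge-on at `13/25` ⇒ both plates have `sin²(basal tilt) > 3/5`** (`S_i² = 1 − (L_i⁻¹e₃)₂²`). -/
theorem sinTilt_sq_gt_of_edgeOnAt {σ₁ σ₂ : ℤ → ℤ} {L₁ L₂ : E3 ≃ₗᵢ[ℝ] E3} (h : EdgeOnAt (13 / 25) σ₁ σ₂ L₁ L₂) :
    3 / 5 < 1 - (L₁.symm (EuclideanSpace.single (2 : Fin 3) (1 : ℝ))) 2 ^ 2 ∧
      3 / 5 < 1 - (L₂.symm (EuclideanSpace.single (2 : Fin 3) (1 : ℝ))) 2 ^ 2 := by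
  have he : ‖(e₃ : E3)‖ = 1 := by rw [e₃, PiLp.norm_single, norm_one]
  have he' : ‖(-e₃ : E3)‖ = 1 := by rw [norm_neg, he]
  have hn : ∀ (L : E3 ≃ₗᵢ[ℝ] E3) (v : E3), ‖v‖ = 1 →
      (L.symm v) 0 ^ 2 + (L.symm v) 1 ^ 2 + (L.symm v) 2 ^ 2 = 1 := by
    intro L v hv
    rw [← Literature.Algebra.EuclideanLattices.norm_sq_fin_three, LinearIsometryEquiv.norm_map, hv, one_pow]
  obtain ⟨h₁, h₂⟩ := h
  have k₁ := lateral_sq_gt_of_not_fluxFeasible L₁ σ₁ he h₁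
  have k₂ := lateral_sq_gt_of_not_fluxFeasible L₂ σ₂ he' h₂
  have n₁ := hn L₁ e₃ he
  have n₂ := hn L₂ (-e₃) he'
  have hneg : ∀ l : Fin 3, (L₂.symm (-e₃)) l ^ 2 = (L₂.symm e₃) l ^ 2 := fun l => by rw [map_neg, PiLp.neg_apply, neg_sq]
  rw [hneg 0, hneg 1, hneg 2] at n₂
  rw [hneg 0, hneg 1] at k₂
  refine ⟨?_, ?_⟩
  · rw [show (EuclideanSpace.single (2 : Fin 3) (1 : ℝ) : E3) = e₃ from rfl]; linarith
  · rw [show (EuclideanSpace.single (2 : Fin 3) (1 : ℝ) : E3) = e₃ from rfl]; linarith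

/-- **Edge-on at `13/25` ⇒ `√(3/5) ≤ S₁`, `√(3/5) ≤ S₂`, `2·√(3/5) ≤ S₁ + S₂`** in the currency of …LevelReachPlatesFluxAreaCell. -/
theorem sinTilt_ge_of_edgeOnAt {σ₁ σ₂ : ℤ → ℤ} {L₁ L₂ : E3 ≃ₗᵢ[ℝ] E3} (h : EdgeOnAt (13 / 25) σ₁ σ₂ L₁ L₂) :
    Real.sqrt (3 / 5) ≤ Real.sqrt (1 - (L₁.symm (EuclideanSpace.single (2 : Fin 3) (1 : ℝ))) 2 ^ 2) ∧
      Real.sqrt (3 / 5) ≤ Real.sqrt (1 - (L₂.symm (EuclideanSpace.single (2 : Fin 3) (1 : ℝ))) 2 ^ 2) ∧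
      2 * Real.sqrt (3 / 5) ≤ Real.sqrt (1 - (L₁.symm (EuclideanSpace.single (2 : Fin 3) (1 : ℝ))) 2 ^ 2) +
        Real.sqrt (1 - (L₂.symm (EuclideanSpace.single (2 : Fin 3) (1 : ℝ))) 2 ^ 2) := by
  obtain ⟨h₁, h₂⟩ := sinTilt_sq_gt_of_edgeOnAt h
  have a := Real.sqrt_le_sqrt h₁.le
  have b := Real.sqrt_le_sqrt h₂.le
  exact ⟨a, b, by linarith⟩

end Summit.Ventures.Crystal3D.Theorems

end
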